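import Summits.Ventures.HSemireg.WedgeHankelSubstitutionShearJordanBasis

/-!
# Venture HSemireg — ALL INTERSECTIONS OF THE KERNEL AND IMAGE FLAGS OF THE SHEAR IN CHARACTERISTIC `p` are spanned by Jordan vectors:
# `range N^j ⊓ ker N^k = span{J_m : j ≤ m mod p, and m mod p + k ≥ p or m + k > n}`, of dimension the number of such `m` (K1's `rank N^k − rank N^{k+1}` count is the case `j = k, k = 1`)

HONEST FRAMING. Part of the Lean index of the computation cell `pub-hsemireg` (seat p10 gen 22, Sunday typer «UNIFORM-IN-n»).
Finite-dimensional EXTERIOR ALGEBRA + linear algebra ONLY: no variety, no cohomology theory, no sheaf, no Ext group, no semiregularity map;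
nothing here says that HC / HC_CM / HC_AV holds; no Literature fact is declared or used.  Custodian versions as in `WedgeHankelSiegelIdeal` (1/3) and `WedgeHankelFrameChange`;
the dictionary (a Jordan basis splits every `range N^j ∩ ker N^k`) is QUOTED, never asserted.

WHAT IS IN THE TREE.  K21 (`WedgeHankelSubstitutionShearJordanBasis`): the Jordan basis `J_m = N^{m mod p}E_{p⌊m/p⌋}` (`linearIndependent_jordan`, `span_jordan_eq_top`),
`ker_pow_shear_sub_one_eq_span_jordan` (`ker N^k = span{J_m : m mod p + k ≥ p ∨ m + k > n}`), `range_pow_shear_sub_one_eq_span_jordan` (`range N^k = span{J_m : m mod p ≥ k}`); K1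
`finrank_range_pow_inf_ker_SbC_shear_char` (`dim (range N^k ⊓ ker N) = ⌊n/p⌋ + [k ≤ n mod p]` by counting).  THIS FILE (namespace `Summit.Ventures.HSemireg.Wedge.HankelFrameChange`
continued; imports K21):
* §348 GENERALITY for a basis `b`: `mem_span_range_restrict_iff` (`v ∈ span{b i : P i} ⇔ repr v` vanishes off `P`), **`span_range_restrict_inf`** (`span{b i : P i} ⊓ span{b i : Q i}
  = span{b i : P i ∧ Q i}`), `finrank_span_range_restrict` (`= #{i : P i}`).
* §349 THE SHEAR: **`range_pow_inf_ker_pow_shear_eq_span_jordan`: `range N^j ⊓ ker N^k = span{J_m : j ≤ m mod p ∧ (p ≤ m mod p + k ∨ n < m + k)}`** (characteristic `p`, `λ ≠ 0`,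
  every `j, k`), **`finrank_range_pow_inf_ker_pow_shear_char`** (`= #{m ≤ n : …}`), `finrank_ker_pow_shear_char_eq_card` / `finrank_range_pow_shear_char_eq_card` (K1's and K21's
  dimensions re-read as counts of Jordan vectors).
NOT typed here: the closed form `Σ_i min(k, (ℓ_i − j)⁺)` of the count over the blocks; anything Ext-side.  New names only.
-/

open Module

namespace Summit.Ventures.HSemireg.Wedge.HankelFrameChange

open Summit.Ventures.HSemireg.Wedge Summit.Ventures.HSemireg.Wedge.Kunneth Summit.Ventures.HSemireg.Wedge.Hankel
  Summit.Ventures.HSemireg.Wedge.BasisFree Summit.Ventures.HSemireg.Wedge.HankelSiegel Summit.Ventures.HSemireg.Wedge.HankelSiegelIdeal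
  Summit.Ventures.HSemireg.Wedge.KunnethKernel Summit.Ventures.HSemireg.Wedge.HankelRankOne Summit.Ventures.HSemireg.Wedge.KernelDuality

variable (K : Type*) [Field K] {n : ℕ}

/-! ## §348. Generality: spans of sub-families of a basis -/

section SubBasis

variable {V : Type*} [AddCommGroup V] [Module K V] {ι : Type*}

/-- **`v ∈ span{b i : P i}` iff the coordinates of `v` vanish off `P`.** -/
theorem mem_span_range_restrict_iff (b : Basis ι K V) (P : ι → Prop) (v : V) :
    v ∈ Submodule.span K (Set.range fun i : {i // P i} => b i) ↔ ∀ i, ¬ P i → b.repr v i = 0 := by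
  have hs : (Set.range fun i : {i // P i} => b i) = b '' {i | P i} := by
    ext x
    simp only [Set.mem_range, Set.mem_image, Set.mem_setOf_eq, Subtype.exists, exists_prop]
  rw [hs, Basis.mem_span_image]
  constructor
  · intro h i hi
    by_contra hne
    exact hi (h (Finsupp.mem_support_iff.mpr hne))
  · intro h i hi
    by_contra hP
    exact (Finsupp.mem_support_iff.mp hi) (h i hP)

/-- **the span of a sub-family meets the span of another in the span of the common sub-family: `span{b i : P i} ⊓ span{b i : Q i} = span{b i : P i ∧ Q i}`.** -/
theorem span_range_restrict_inf (b : Basis ι K V) (P Q : ι → Prop) :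
    Submodule.span K (Set.range fun i : {i // P i} => b i) ⊓ Submodule.span K (Set.range fun i : {i // Q i} => b i) =
      Submodule.span K (Set.range fun i : {i // P i ∧ Q i} => b i) := by
  ext v
  rw [Submodule.mem_inf, mem_span_range_restrict_iff, mem_span_range_restrict_iff, mem_span_range_restrict_iff]
  constructor
  · rintro ⟨hP, hQ⟩ i hi
    by_cases hp : P i
    · exact hQ i (fun hq => hi ⟨hp, hq⟩)
    · exact hP i hp
  · intro h
    exact ⟨fun i hi => h i (fun hpq => hi hpq.1), fun i hi => h i (fun hpq => hi hpq.2)⟩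

/-- `dim span{b i : P i} = #{i : P i}`. -/
theorem finrank_span_range_restrict [Fintype ι] (b : Basis ι K V) (P : ι → Prop) [DecidablePred P] :
    finrank K ↥(Submodule.span K (Set.range fun i : {i // P i} => b i)) = (Finset.univ.filter P).card := by
  have hli : LinearIndependent K fun i : {i // P i} => b i := b.linearIndependent.comp _ Subtype.val_injective
  rw [finrank_span_eq_card hli, Fintype.card_subtype]

end SubBasis

/-! ## §349. The shear: every `range N^j ⊓ ker N^k` is spanned by Jordan vectors -/

/-- **`range N^j ⊓ ker N^k = span{J_m : j ≤ m mod p ∧ (p ≤ m mod p + k ∨ n < m + k)}`** (characteristic `p`, `λ ≠ 0`, every `j, k`; K21's two flags in the Jordan basis). -/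
theorem range_pow_inf_ker_pow_shear_eq_span_jordan {lam : K} (hlam : lam ≠ 0) (p : ℕ) [Fact p.Prime] [CharP K p] (j k : ℕ) :
    LinearMap.range ((SbC K 1 lam 0 1 (n := n) - 1) ^ j) ⊓ LinearMap.ker ((SbC K 1 lam 0 1 (n := n) - 1) ^ k) =
      Submodule.span K (Set.range fun m : {m : Fin (n + 1) // j ≤ (m : ℕ) % p ∧ (p ≤ (m : ℕ) % p + k ∨ n < (m : ℕ) + k)} =>
        ((SbC K 1 lam 0 1 - 1) ^ (((m : Fin (n + 1)) : ℕ) % p)) (spikeBasis K n ⟨p * ((((m : Fin (n + 1)) : ℕ)) / p), mul_div_lt_succ p (m : Fin (n + 1))⟩)) := by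
  let b : Basis (Fin (n + 1)) K (spikeSpan K n) := Basis.mk (linearIndependent_jordan K hlam p) (span_jordan_eq_top K hlam p).ge
  have hb : ∀ m : Fin (n + 1), b m = ((SbC K 1 lam 0 1 - 1) ^ ((m : ℕ) % p)) (spikeBasis K n ⟨p * ((m : ℕ) / p), mul_div_lt_succ p m⟩) := fun m => Basis.mk_apply _ _ m
  have e1 : (fun m : {m : Fin (n + 1) // j ≤ (m : ℕ) % p} => ((SbC K 1 lam 0 1 - 1) ^ (((m : Fin (n + 1)) : ℕ) % p))
      (spikeBasis K n ⟨p * ((((m : Fin (n + 1)) : ℕ)) / p), mul_div_lt_succ p (m : Fin (n + 1))⟩)) = fun m : {m : Fin (n + 1) // j ≤ (m : ℕ) % p} => b m :=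
    funext fun m => (hb m).symm
  have e2 : (fun m : {m : Fin (n + 1) // p ≤ (m : ℕ) % p + k ∨ n < (m : ℕ) + k} => ((SbC K 1 lam 0 1 - 1) ^ (((m : Fin (n + 1)) : ℕ) % p))
      (spikeBasis K n ⟨p * ((((m : Fin (n + 1)) : ℕ)) / p), mul_div_lt_succ p (m : Fin (n + 1))⟩)) = fun m : {m : Fin (n + 1) // p ≤ (m : ℕ) % p + k ∨ n < (m : ℕ) + k} => b m :=
    funext fun m => (hb m).symm
  have e3 : (fun m : {m : Fin (n + 1) // j ≤ (m : ℕ) % p ∧ (p ≤ (m : ℕ) % p + k ∨ n < (m : ℕ) + k)} => ((SbC K 1 lam 0 1 - 1) ^ (((m : Fin (n + 1)) : ℕ) % p))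
      (spikeBasis K n ⟨p * ((((m : Fin (n + 1)) : ℕ)) / p), mul_div_lt_succ p (m : Fin (n + 1))⟩)) =
      fun m : {m : Fin (n + 1) // j ≤ (m : ℕ) % p ∧ (p ≤ (m : ℕ) % p + k ∨ n < (m : ℕ) + k)} => b m :=
    funext fun m => (hb m).symm
  rw [range_pow_shear_sub_one_eq_span_jordan K hlam p j, ker_pow_shear_sub_one_eq_span_jordan K hlam p k, e1, e2, e3]
  exact span_range_restrict_inf K b _ _

open Classical in
/-- **`dim (range N^j ⊓ ker N^k) = #{m ≤ n : j ≤ m mod p ∧ (p ≤ m mod p + k ∨ n < m + k)}`** (characteristic `p`, `λ ≠ 0`). -/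
theorem finrank_range_pow_inf_ker_pow_shear_char {lam : K} (hlam : lam ≠ 0) (p : ℕ) [Fact p.Prime] [CharP K p] (j k : ℕ) :
    finrank K ↥(LinearMap.range ((SbC K 1 lam 0 1 (n := n) - 1) ^ j) ⊓ LinearMap.ker ((SbC K 1 lam 0 1 (n := n) - 1) ^ k)) =
      (Finset.univ.filter fun m : Fin (n + 1) => j ≤ (m : ℕ) % p ∧ (p ≤ (m : ℕ) % p + k ∨ n < (m : ℕ) + k)).card := by
  let b : Basis (Fin (n + 1)) K (spikeSpan K n) := Basis.mk (linearIndependent_jordan K hlam p) (span_jordan_eq_top K hlam p).ge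
  have hb : ∀ m : Fin (n + 1), b m = ((SbC K 1 lam 0 1 - 1) ^ ((m : ℕ) % p)) (spikeBasis K n ⟨p * ((m : ℕ) / p), mul_div_lt_succ p m⟩) := fun m => Basis.mk_apply _ _ m
  have e3 : (fun m : {m : Fin (n + 1) // j ≤ (m : ℕ) % p ∧ (p ≤ (m : ℕ) % p + k ∨ n < (m : ℕ) + k)} => ((SbC K 1 lam 0 1 - 1) ^ (((m : Fin (n + 1)) : ℕ) % p))
      (spikeBasis K n ⟨p * ((((m : Fin (n + 1)) : ℕ)) / p), mul_div_lt_succ p (m : Fin (n + 1))⟩)) =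
      fun m : {m : Fin (n + 1) // j ≤ (m : ℕ) % p ∧ (p ≤ (m : ℕ) % p + k ∨ n < (m : ℕ) + k)} => b m :=
    funext fun m => (hb m).symm
  rw [range_pow_inf_ker_pow_shear_eq_span_jordan K hlam p j k, e3, finrank_span_range_restrict K b]

open Classical in
/-- `dim ker N^k = #{m ≤ n : p ≤ m mod p + k ∨ n < m + k}` (K1's `⌊n/p⌋·min(k,p) + min(k, n mod p + 1)`, re-read as a count of Jordan vectors). -/
theorem finrank_ker_pow_shear_char_eq_card {lam : K} (hlam : lam ≠ 0) (p : ℕ) [Fact p.Prime] [CharP K p] (k : ℕ) :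
    finrank K ↥(LinearMap.ker ((SbC K 1 lam 0 1 (n := n) - 1) ^ k)) = (Finset.univ.filter fun m : Fin (n + 1) => p ≤ (m : ℕ) % p + k ∨ n < (m : ℕ) + k).card := by
  let b : Basis (Fin (n + 1)) K (spikeSpan K n) := Basis.mk (linearIndependent_jordan K hlam p) (span_jordan_eq_top K hlam p).ge
  have hb : ∀ m : Fin (n + 1), b m = ((SbC K 1 lam 0 1 - 1) ^ ((m : ℕ) % p)) (spikeBasis K n ⟨p * ((m : ℕ) / p), mul_div_lt_succ p m⟩) := fun m => Basis.mk_apply _ _ m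
  have e2 : (fun m : {m : Fin (n + 1) // p ≤ (m : ℕ) % p + k ∨ n < (m : ℕ) + k} => ((SbC K 1 lam 0 1 - 1) ^ (((m : Fin (n + 1)) : ℕ) % p))
      (spikeBasis K n ⟨p * ((((m : Fin (n + 1)) : ℕ)) / p), mul_div_lt_succ p (m : Fin (n + 1))⟩)) = fun m : {m : Fin (n + 1) // p ≤ (m : ℕ) % p + k ∨ n < (m : ℕ) + k} => b m :=
    funext fun m => (hb m).symm
  rw [ker_pow_shear_sub_one_eq_span_jordan K hlam p k, e2, finrank_span_range_restrict K b]

open Classical in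
/-- `rank N^k = #{m ≤ n : k ≤ m mod p}`. -/
theorem finrank_range_pow_shear_char_eq_card {lam : K} (hlam : lam ≠ 0) (p : ℕ) [Fact p.Prime] [CharP K p] (k : ℕ) :
    finrank K ↥(LinearMap.range ((SbC K 1 lam 0 1 (n := n) - 1) ^ k)) = (Finset.univ.filter fun m : Fin (n + 1) => k ≤ (m : ℕ) % p).card := by
  let b : Basis (Fin (n + 1)) K (spikeSpan K n) := Basis.mk (linearIndependent_jordan K hlam p) (span_jordan_eq_top K hlam p).ge
  have hb : ∀ m : Fin (n + 1), b m = ((SbC K 1 lam 0 1 - 1) ^ ((m : ℕ) % p)) (spikeBasis K n ⟨p * ((m : ℕ) / p), mul_div_lt_succ p m⟩) := fun m => Basis.mk_apply _ _ m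
  have e1 : (fun m : {m : Fin (n + 1) // k ≤ (m : ℕ) % p} => ((SbC K 1 lam 0 1 - 1) ^ (((m : Fin (n + 1)) : ℕ) % p))
      (spikeBasis K n ⟨p * ((((m : Fin (n + 1)) : ℕ)) / p), mul_div_lt_succ p (m : Fin (n + 1))⟩)) = fun m : {m : Fin (n + 1) // k ≤ (m : ℕ) % p} => b m :=
    funext fun m => (hb m).symm
  rw [range_pow_shear_sub_one_eq_span_jordan K hlam p k, e1, finrank_span_range_restrict K b]

end Summit.Ventures.HSemireg.Wedge.HankelFrameChange
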